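import Summits.QuantumFields.BalabanUV.T4Continuum.Support.ShellMeasureLandauCorrectionB7Local
import Summits.QuantumFields.BalabanUV.T4Continuum.Support.ShellMeasureLandauCfPinned

/-!
# `T4Continuum.ShellMeasureLandauCfBoxLocal` — row S99 f3a: THE BOX-LOCAL CUT-OFF OF B7's `C_k(U₀, ·)` — END-II's w-tuple
# Landau-correction letter `Cw` with ALL FOUR binder families at once (pair `hCqw`∕`hCdw`, exact locality `hlocC`, reality
# `hCrw` + `IsClosed`), from the LOCATED background binder of file 1
(cell `pub-balaban`, sub-cell `t4`, spine estimate NE7c (node U5b); NE7c ROUND-2 crew `t4-ne7c-formalise-*`, seat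
`b2b-balaban-t4-ne7c-formalise-leaf-07` gen 9; owner-table row **S99** «R11 LOCATED — S64 ON THE BOXES + THE Cf-SLOT FIRED»
(R-ne7cp1-g35-1 (b), journal l.20233: f3 = S80 f6's three tuples, on f2's ACCEPT); this is f3a = the w-tuple letter, f3b =
the END fired; ADDITIVE — imports f1 `ShellMeasureLandauCorrectionB7Local` + CfP `ShellMeasureLandauCfPinned` ONLY (CfP for f3b's e-tuple call); [folklore];
TWO data `def`s (`boxTrunc`, `landauCfBox`), 0 `def … : Prop`, 0 sorry, 0 citation tags.)

HONEST FRAMING.  Finite four-torus programme, rung (B)+1 only — NOT infinite volume, NOT a mass gap, NOT the Clay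
problem, NOT summit progress; (B), `BetaPertHyp`, (B^μ) not consumed.  NE7c (`T4IndicatorShell.ShellWeightBound`) is NOT
PRINTED and NOT PROVED; «NE7c ⇐ the named binders» (trigger c3).  PLUMBING on OUR side of WALL §2 (a): B7 Prop. 4 is kernel
(S56∕S64); the background's located plaquette regularity stays DISPLAYED (file 1's `h52loc`); node O's identification of the
slot untouched.  HONEST DEPENDENCY (cell): continuum YM on T⁴ ⇐ BetaPertH ∧ nine spine estimates (0/9 proved); BetaPertH ⇐
(D1) ∧ (D4) ∧ CAP+tail; G-an2-4 gates asym, D1 and NE2/3/4.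

THE POINT.  S80 f6's w-tuple takes its Landau-correction letter `Cw V : (Λw′ → 𝔄′) → (Λx → 𝔅)` on FLAT pi-types with FOUR
binder families: the pair `hCqw`∕`hCdw` on `ball 0 RCw`, EXACT LOCALITY `hlocC` w.r.t. a stencil `NC` (for all fields, not only
in the ball), REALITY `hCrw : ∀ Z ∈ 𝓡𝒴w′, Cw V Z ∈ 𝓡𝒳w` (for all real fields) and `IsClosed 𝓡𝒳w`.  For `landauCf` the two
devices already in the tree conflict: S64 f2's GLOBAL-ball cut-off `(ball 0 RC).indicator landauCf` is NOT box-local (it reads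
`‖A‖` over all bonds), while the raw `landauCf` is skew only ON the ball (`landauCf_mem_skewPi`; off the ball the matrix
logarithms leave the chart).  THE CUT-OFF PER OUTPUT BOND resolves it: `landauCfBox L U₀ k S S′ R A c := C_k(U₀, A|_{box c})(c)`
if `‖A|_{box c}‖ < R`, else `0`, where `A|_{box c} = boxTrunc c A` keeps the variables on `B^k(c₋) ∪ B^k(c₊)` and zeroes the rest —
box-local BY CONSTRUCTION, EQUAL to `landauCf` on the global ball (S68 (b) `landauCf_congr`: `C_k(U₀, A)(c)` reads `A` on the box
only, and `‖A|_{box}‖ ≤ ‖A‖`), skew for every skew `A` (file 1 §4 on the truncated field, or `0`).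

WHAT IS PROVED ([folklore]).  §1 `boxTrunc` (data) with `boxTrunc_apply_of_mem`∕`_of_not_mem`, `norm_boxTrunc_le`, `boxTrunc_congr`,
`boxTrunc_mem_skewPi`, `landauCf_boxTrunc`.  §2 `landauCfBox` (data) with `landauCfBox_eq_of_norm_lt` (= `landauCf` on the ball),
**`landauCfBox_local`** (`hlocC` with `NC c s :≡ s ⊂ B^k(c₋)∪B^k(c₊)`), **`landauCfBox_binders_local`** (`hCqw`∕`hCdw` at
`C2cov d`, `landauRad d L` from file 1 §2), **`landauCfBox_mem_skewPi_local`** ∕ **`landauCfBox_real_binders_local`** (`hCrw` for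
ALL skew fields + `IsClosed (skewPi S′)`, unitary background regular on the boxes), `landauCfBox_real_binders_flat` (background
`1`: no hypothesis).  (The e-tuple's PINNED pair from the located binder is ONE call of CfP's generic
`conj_binders_of_local` over file 1 §2 + S68 (b) `landauCf_congr` — made inside f3b's proof, not restated here: a located twin of
CfP's `landauCf_pinned_binders` would be its conclusion verbatim.)
-/

noncomputable section

open Set Metric

namespace Summit.QuantumFields.BalabanUV.T4Continuum.ShellMeasureLandauCfBoxLocal

open Literature.MathematicalPhysics.QuantumFieldTheory.Balaban1983to89
open B7Prop1Explicit (Site)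
open B7Prop2Explicit (AvgClosed C0 c2' unitaryUnits pdev)
open B7Prop1Local (loK bondHiK pdevOn)
open B7Prop5Flat (BondIn)
open ShellMeasureAverageProp4General (C1cov O1cov C2cov C1cov_pos)
open ShellMeasureLandauCorrectionB7 (landauCf landauRad)
open ShellMeasureAverageLocality148 (landauCf_congr)
open ShellMeasureLandauCorrectionReal (skewPi mem_skewPi isClosed_skewPi)
open ShellMeasureLandauCorrectionB7Flat (regime_exists pdev_one)
open ShellMeasureLandauCorrectionB7Local (norm_landauCf_le_local differentiableOn_landauCf_local landauCf_mem_skewPi_local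
  pdevOn_le_pdev)

variable {d : ℕ}

/-! ## §1 Truncation of a bond field to the box `B^k(c₋) ∪ B^k(c₊)` of an output bond -/

section Trunc

variable {𝔸 : Type*} [NormedRing 𝔸]

open scoped Classical in
/-- `A|_{box c}`: the bond field keeping the variables `A_s` for `s ⊂ B^k(c₋) ∪ B^k(c₊) = [loK L k c₋, bondHiK L k c₋ κ]` and
zero elsewhere (data). -/
def boxTrunc (L k : ℕ) (S S' : Finset (Site d × Fin d)) (c : ↥S') (A : ↥S → 𝔸) : ↥S → 𝔸 :=
  fun s => if BondIn (loK L k c.1.1) (bondHiK L k c.1.1 c.1.2) s.1.1 s.1.2 then A s else 0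

variable (L k : ℕ) (S S' : Finset (Site d × Fin d))

/-- inside the box the truncation is `A`. [folklore] -/
theorem boxTrunc_apply_of_mem (c : ↥S') (A : ↥S → 𝔸) {s : ↥S}
    (hs : BondIn (loK L k c.1.1) (bondHiK L k c.1.1 c.1.2) s.1.1 s.1.2) : boxTrunc L k S S' c A s = A s := by
  unfold boxTrunc; exact if_pos hs

/-- outside the box the truncation is `0`. [folklore] -/
theorem boxTrunc_apply_of_not_mem (c : ↥S') (A : ↥S → 𝔸) {s : ↥S}
    (hs : ¬ BondIn (loK L k c.1.1) (bondHiK L k c.1.1 c.1.2) s.1.1 s.1.2) : boxTrunc L k S S' c A s = 0 := by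
  unfold boxTrunc; exact if_neg hs

/-- truncation does not increase the sup norm. [folklore] -/
theorem norm_boxTrunc_le (c : ↥S') (A : ↥S → 𝔸) : ‖boxTrunc L k S S' c A‖ ≤ ‖A‖ := by
  refine (pi_norm_le_iff_of_nonneg (norm_nonneg A)).2 fun s => ?_
  by_cases hs : BondIn (loK L k c.1.1) (bondHiK L k c.1.1 c.1.2) s.1.1 s.1.2
  · rw [boxTrunc_apply_of_mem L k S S' c A hs]; exact norm_le_pi_norm A s
  · rw [boxTrunc_apply_of_not_mem L k S S' c A hs, norm_zero]; exact norm_nonneg A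

/-- two fields agreeing on the box have the same truncation (exact locality of the truncation). [folklore] -/
theorem boxTrunc_congr (c : ↥S') {A A' : ↥S → 𝔸}
    (h : ∀ s : ↥S, BondIn (loK L k c.1.1) (bondHiK L k c.1.1 c.1.2) s.1.1 s.1.2 → A s = A' s) :
    boxTrunc L k S S' c A = boxTrunc L k S S' c A' := by
  funext s
  by_cases hs : BondIn (loK L k c.1.1) (bondHiK L k c.1.1 c.1.2) s.1.1 s.1.2
  · rw [boxTrunc_apply_of_mem L k S S' c A hs, boxTrunc_apply_of_mem L k S S' c A' hs, h s hs]
  · rw [boxTrunc_apply_of_not_mem L k S S' c A hs, boxTrunc_apply_of_not_mem L k S S' c A' hs]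

end Trunc

section TruncAlg

variable {𝔸 : Type*} [NormedRing 𝔸] [NormedAlgebra ℂ 𝔸] [CompleteSpace 𝔸]
variable (L k : ℕ) (S S' : Finset (Site d × Fin d))

/-- **`C_k(U₀, A|_{box c})(c) = C_k(U₀, A)(c)`** — S68 (b) `landauCf_congr` (the map reads `A` on the box only). [folklore] -/
theorem landauCf_boxTrunc (hL : 1 ≤ L) (U₀ : Site d → Fin d → 𝔸ˣ) (c : ↥S') (A : ↥S → 𝔸) :
    landauCf L U₀ k S S' (boxTrunc L k S S' c A) c = landauCf L U₀ k S S' A c :=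
  landauCf_congr hL U₀ k S S' c fun _ hs => boxTrunc_apply_of_mem L k S S' c A hs

end TruncAlg

section TruncSkew

variable {𝔸 : Type*} [CStarAlgebra 𝔸]
variable (L k : ℕ) (S S' : Finset (Site d × Fin d))

/-- the truncation of a skew field is skew (coordinates `A_s` or `0`). [folklore] -/
theorem boxTrunc_mem_skewPi (c : ↥S') {A : ↥S → 𝔸} (hA : A ∈ skewPi ↥S) : boxTrunc L k S S' c A ∈ skewPi ↥S := by
  rw [mem_skewPi] at hA ⊢
  intro s
  by_cases hs : BondIn (loK L k c.1.1) (bondHiK L k c.1.1 c.1.2) s.1.1 s.1.2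
  · rw [boxTrunc_apply_of_mem L k S S' c A hs]; exact hA s
  · rw [boxTrunc_apply_of_not_mem L k S S' c A hs, star_zero, neg_zero]

end TruncSkew

/-! ## §2 The box-local cut-off `landauCfBox` and its four binder families -/

section Box

variable {𝔸 : Type*} [NormedRing 𝔸] [NormedAlgebra ℂ 𝔸] [CompleteSpace 𝔸] [NormOneClass 𝔸]

open scoped Classical in
/-- **THE BOX-LOCAL CUT-OFF OF `C_k(U₀, ·)`** (data): at the output bond `c`, `C_k(U₀, A|_{box c})(c)` if `‖A|_{box c}‖ < R`,
else `0` — END-II's w-tuple letter `Cw`. -/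
def landauCfBox (L : ℕ) (U₀ : Site d → Fin d → 𝔸ˣ) (k : ℕ) (S S' : Finset (Site d × Fin d)) (R : ℝ)
    (A : ↥S → 𝔸) : ↥S' → 𝔸 :=
  fun c => if ‖boxTrunc L k S S' c A‖ < R then landauCf L U₀ k S S' (boxTrunc L k S S' c A) c else 0

variable (L : ℕ) (U₀ : Site d → Fin d → 𝔸ˣ) (k : ℕ) (S S' : Finset (Site d × Fin d)) (R : ℝ)

omit [NormOneClass 𝔸] in
/-- component formula inside the local ball. [folklore] -/
theorem landauCfBox_apply_of_lt {A : ↥S → 𝔸} {c : ↥S'} (h : ‖boxTrunc L k S S' c A‖ < R) :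
    landauCfBox L U₀ k S S' R A c = landauCf L U₀ k S S' (boxTrunc L k S S' c A) c := by
  unfold landauCfBox; exact if_pos h

omit [NormOneClass 𝔸] in
/-- component formula outside the local ball. [folklore] -/
theorem landauCfBox_apply_of_not_lt {A : ↥S → 𝔸} {c : ↥S'} (h : ¬ ‖boxTrunc L k S S' c A‖ < R) :
    landauCfBox L U₀ k S S' R A c = 0 := by
  unfold landauCfBox; exact if_neg h

omit [NormOneClass 𝔸] in
/-- **ON THE GLOBAL BALL THE CUT-OFF IS `C_k(U₀, ·)` ITSELF** (`‖A|_{box}‖ ≤ ‖A‖ < R`, then `landauCf_boxTrunc`). [folklore] -/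
theorem landauCfBox_eq_of_norm_lt (hL : 1 ≤ L) {A : ↥S → 𝔸} (hA : ‖A‖ < R) :
    landauCfBox L U₀ k S S' R A = landauCf L U₀ k S S' A := by
  funext c
  rw [landauCfBox_apply_of_lt L U₀ k S S' R ((norm_boxTrunc_le L k S S' c A).trans_lt hA),
    landauCf_boxTrunc L k S S' hL U₀ c A]

omit [NormOneClass 𝔸] in
/-- **`hlocC` — EXACT LOCALITY FOR ALL FIELDS**: `landauCfBox … A c` depends on `A_s` only for `s ⊂ B^k(c₋) ∪ B^k(c₊)` (the
stencil `NC c s :≡ BondIn (loK L k c₋) (bondHiK L k c₋ κ) s`). [folklore] -/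
theorem landauCfBox_local (A A' : ↥S → 𝔸) (c : ↥S')
    (h : ∀ s : ↥S, BondIn (loK L k c.1.1) (bondHiK L k c.1.1 c.1.2) s.1.1 s.1.2 → A s = A' s) :
    landauCfBox L U₀ k S S' R A c = landauCfBox L U₀ k S S' R A' c := by
  unfold landauCfBox
  rw [boxTrunc_congr L k S S' c h]

variable (hL : 2 ≤ L) {G : Subgroup 𝔸ˣ} (hG : AvgClosed d L G) (hU₀ : ∀ x κ, U₀ x κ ∈ G) {α₀ : ℝ} (hα : 0 < α₀)
  (hα3 : C0 d * α₀ ≤ 1 / 3) (hα4 : 4 * α₀ ≤ c2' d L) (hα6 : 4 * O1cov d * α₀ ≤ 1 / 3)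
  (h52loc : ∀ c : S', pdevOn (loK L k c.1.1) (bondHiK L k c.1.1 c.1.2) U₀ < α₀ * (((L : ℝ) ^ k)⁻¹) ^ 2)

include hL hG hU₀ hα hα3 hα4 hα6 h52loc in
/-- **`hCqw`∕`hCdw` FOR THE BOX-LOCAL CUT-OFF** at `C₂ := C2cov d`, `RC := landauRad d L`, from file 1's located pair (the two maps
agree on the ball). [folklore] -/
theorem landauCfBox_binders_local :
    (∀ A : ↥S → 𝔸, ‖A‖ < landauRad d L → ‖landauCfBox L U₀ k S S' (landauRad d L) A‖ ≤ C2cov d * ‖A‖ ^ 2) ∧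
      DifferentiableOn ℂ (landauCfBox L U₀ k S S' (landauRad d L)) (ball 0 (landauRad d L)) := by
  have hL1 : 1 ≤ L := le_trans (by norm_num) hL
  refine ⟨fun A hA => ?_, ?_⟩
  · rw [landauCfBox_eq_of_norm_lt L U₀ k S S' _ hL1 hA]
    exact norm_landauCf_le_local L hL hG k U₀ hU₀ hα hα3 hα4 hα6 S S' h52loc hA.le
  · exact (differentiableOn_landauCf_local L hL hG k U₀ hU₀ hα hα3 hα4 hα6 S S' h52loc).congr
      fun A hA => landauCfBox_eq_of_norm_lt L U₀ k S S' _ hL1 (mem_ball_zero_iff.1 hA)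

end Box

section BoxReal

variable {𝔸 : Type*} [CStarAlgebra 𝔸] [Nontrivial 𝔸] {L : ℕ}
  (hL : 2 ≤ L) (k : ℕ) (U₀ : Site d → Fin d → 𝔸ˣ) (hU₀ : ∀ x κ, U₀ x κ ∈ unitaryUnits 𝔸) {α₀ : ℝ} (hα : 0 < α₀)
  (hα3 : C0 d * α₀ ≤ 1 / 3) (hα4 : 4 * α₀ ≤ c2' d L) (hα6 : 4 * O1cov d * α₀ ≤ 1 / 3)
  (S S' : Finset (Site d × Fin d))
  (h52loc : ∀ c : S', pdevOn (loK L k c.1.1) (bondHiK L k c.1.1 c.1.2) U₀ < α₀ * (((L : ℝ) ^ k)⁻¹) ^ 2)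

include hL hU₀ hα hα3 hα4 hα6 h52loc in
/-- **`hCrw` FOR ALL SKEW FIELDS**: for a UNITARY background regular on the boxes, `A ∈ skewPi S` gives
`landauCfBox … (landauRad d L) A ∈ skewPi S′` — inside the local ball by file 1 §4 on the (skew, small) truncated field, outside
it is `0`. [folklore] -/
theorem landauCfBox_mem_skewPi_local {A : ↥S → 𝔸} (hA : A ∈ skewPi ↥S) :
    landauCfBox L U₀ k S S' (landauRad d L) A ∈ skewPi ↥S' := by
  rw [mem_skewPi]
  intro c
  by_cases h : ‖boxTrunc L k S S' c A‖ < landauRad d L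
  · rw [landauCfBox_apply_of_lt L U₀ k S S' _ h]
    exact (mem_skewPi.1 (landauCf_mem_skewPi_local hL k U₀ hU₀ hα hα3 hα4 hα6 S S' h52loc
      (boxTrunc_mem_skewPi L k S S' c hA) h)) c
  · rw [landauCfBox_apply_of_not_lt L U₀ k S S' _ h, star_zero, neg_zero]

include hL hU₀ hα hα3 hα4 hα6 h52loc in
/-- **THE w-TUPLE LETTER's BINDERS, LOCATED**: `hCqw`, `hCdw` (at `C2cov d`, `landauRad d L`), `hCrw` for all skew fields with
`𝓡𝒴w′ := skewPi S`, `𝓡𝒳w := skewPi S′`, and `IsClosed (skewPi S′)` — for a UNITARY background regular on the boxes only;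
`hlocC` is `landauCfBox_local` (no hypothesis). [folklore] -/
theorem landauCfBox_real_binders_local :
    (∀ A : ↥S → 𝔸, ‖A‖ < landauRad d L → ‖landauCfBox L U₀ k S S' (landauRad d L) A‖ ≤ C2cov d * ‖A‖ ^ 2) ∧
      DifferentiableOn ℂ (landauCfBox L U₀ k S S' (landauRad d L)) (ball 0 (landauRad d L)) ∧
      (∀ A ∈ skewPi ↥S, landauCfBox L U₀ k S S' (landauRad d L) A ∈ skewPi ↥S') ∧
      IsClosed ((skewPi (𝔸 := 𝔸) ↥S' : AddSubgroup (↥S' → 𝔸)) : Set (↥S' → 𝔸)) :=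
  have hG := B7Prop2Explicit.avgClosed_unitaryUnits d L (𝔸 := 𝔸)
  ⟨(landauCfBox_binders_local L U₀ k S S' hL hG hU₀ hα hα3 hα4 hα6 h52loc).1,
    (landauCfBox_binders_local L U₀ k S S' hL hG hU₀ hα hα3 hα4 hα6 h52loc).2,
    fun _ hA => landauCfBox_mem_skewPi_local hL k U₀ hU₀ hα hα3 hα4 hα6 S S' h52loc hA, isClosed_skewPi _⟩

/-- **… AT THE FLAT BACKGROUND, UNCONDITIONAL** (`U₀ = 1`: `pdev 1 = 0`, `α₀` from S64 f3 `regime_exists`). [folklore] -/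
theorem landauCfBox_real_binders_flat (hL : 2 ≤ L) (k : ℕ) (S S' : Finset (Site d × Fin d)) :
    (∀ A : ↥S → 𝔸, ‖A‖ < landauRad d L →
        ‖landauCfBox L (1 : Site d → Fin d → 𝔸ˣ) k S S' (landauRad d L) A‖ ≤ C2cov d * ‖A‖ ^ 2) ∧
      DifferentiableOn ℂ (landauCfBox L (1 : Site d → Fin d → 𝔸ˣ) k S S' (landauRad d L)) (ball 0 (landauRad d L)) ∧
      (∀ A ∈ skewPi ↥S, landauCfBox L (1 : Site d → Fin d → 𝔸ˣ) k S S' (landauRad d L) A ∈ skewPi ↥S') ∧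
      IsClosed ((skewPi (𝔸 := 𝔸) ↥S' : AddSubgroup (↥S' → 𝔸)) : Set (↥S' → 𝔸)) := by
  have hL1 : 1 ≤ L := le_trans (by norm_num) hL
  obtain ⟨α₀, hα, hα3, hα4, hα6⟩ := regime_exists d hL1
  have hL0 : (0 : ℝ) < L := by exact_mod_cast hL1
  have h1 : ∀ x κ, (1 : Site d → Fin d → 𝔸ˣ) x κ ∈ unitaryUnits 𝔸 := fun _ _ => (unitaryUnits 𝔸).one_mem
  have h52loc : ∀ c : ↥S', pdevOn (loK L k c.1.1) (bondHiK L k c.1.1 c.1.2) (1 : Site d → Fin d → 𝔸ˣ)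
      < α₀ * (((L : ℝ) ^ k)⁻¹) ^ 2 := fun c =>
    (pdevOn_le_pdev _ _ fun x κ => B7Prop2Explicit.unitaryUnits_le_U1 (h1 x κ)).trans_lt
      (by rw [pdev_one]; positivity)
  exact landauCfBox_real_binders_local hL k 1 h1 hα hα3 hα4 hα6 S S' h52loc

end BoxReal


end Summit.QuantumFields.BalabanUV.T4Continuum.ShellMeasureLandauCfBoxLocal

end
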